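import Summits.KontsevichZagierPeriods.KontsevichZagierPeriods.Theses.IsogenyCertificates
import Summits.KontsevichZagierPeriods.KontsevichZagierPeriods.Theorems.IsogenyCertificatesAlgebraicModuliRealPeriodCellPeriodRep
import Literature.NumberTheory.Transcendental.KZLogCalculusProofs
import Mathlib.FieldTheory.AlgebraicClosure

/-!
# `AlgebraicModuliRealPeriodCell` (stmt-KontsevichZagierPeriods-18265, route IsogenyCertificates) —
line `Sketch`, stub `stub_algCellCollapse` (C, the lever of the line)

**Cell collapse over `ℚ̄ ∩ ℝ`.** Port of the parent crux's stub C
(`XMapKernelStubs.CellCollapse.stub_cellCollapse`, Theorems/IsogenyCertificatesXMapKernelStubCellCollapse.lean)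
with the coefficient field `ℚ` replaced by the field `K = algebraicClosure ℚ ℝ` of real algebraic
numbers and the enlarged move group `closure gens` replaced by `KZ.relations` (the x-map transfer T is a
hypothesis here, so the relators ARE relations). Work in `Q := FormalRep ⧸ KZ.relations`. Given

* (S) honest representations `R(p, t) = [{P_p>0}, t/√P_p]` for every nonsingular `p = (α, β) ∈ K²` and
  `t ∈ K`,
* (T) TRANSFER: along a real-algebraic x-rational isogeny datum `p → p'`, equal-valued sector
  representations are congruent modulo `KZ.relations`,
* (V) ORBIT RATIO: along such a datum `Ω(p) = q·Ω(p')` with `q ∈ K_{>0}`,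
* (RPI) REAL-PERIOD INDEPENDENCE: the full real periods of pairwise datum-unrelated nonsingular
  real-algebraic cubics are `K`-linearly independent,

every element of the closure of the sector generators with value `0` lies in `KZ.relations`. Proof:
(1) `t ↦ [R(p,t)]` is ADDITIVE `K → Q` (rule (1b)), so every element of the sector closure is, in `Q`,
`∑_p ψ_p(a_p)` for a finitely supported `a : K × K →₀ K` on nonsingular curves, with value
`∑_p a_p Ω(p)`; (2) if two distinct curves `p ≠ p'` of the support are joined by a datum, (T)+(V)
identify `ψ_p(t) = ψ_{p'}(t q)` for `t > 0`, hence for all `t` by additivity, so the `p`-term moves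
onto `p'` — the support shrinks; (3) a pairwise unrelated support is empty by (RPI). Induction on the
size of the support.

References: Kontsevich–Zagier 2001 §1.2; Huber–Wüstholz 2022 Thm 15.3 (enters only through (RPI)).
-/

noncomputable section

namespace Summit.KontsevichZagierPeriods.IsogenyCertificates.AlgRealPeriodCell.CellCollapse

open scoped BigOperators
open Set MeasureTheory
open Literature.NumberTheory.Transcendental

/-- Rule (1b) for three representations on a common domain whose integrands are literally `t/√P`,
`t₁/√P`, `t₂/√P` with `t = t₁ + t₂`: `[r] − [r₁] − [r₂]` is an integrand-additivity move.
[cite: KontsevichZagier2001, §1.2 rule (1)] -/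
theorem sub_sub_mem_relations_of_integrand {α β t t₁ t₂ : ℝ} (ht : t = t₁ + t₂)
    (r r₁ r₂ : KZ.IntegralRep 1)
    (hd : r.domain = {x | 0 < x 0 ^ 3 + α * x 0 + β})
    (hd₁ : r₁.domain = {x | 0 < x 0 ^ 3 + α * x 0 + β})
    (hd₂ : r₂.domain = {x | 0 < x 0 ^ 3 + α * x 0 + β})
    (hi : r.integrand = fun x => t / Real.sqrt (x 0 ^ 3 + α * x 0 + β))
    (hi₁ : r₁.integrand = fun x => t₁ / Real.sqrt (x 0 ^ 3 + α * x 0 + β))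
    (hi₂ : r₂.integrand = fun x => t₂ / Real.sqrt (x 0 ^ 3 + α * x 0 + β)) :
    KZ.of r - KZ.of r₁ - KZ.of r₂ ∈ KZ.relations := by
  refine KZ.integrandAddRel_subset_relations ⟨1, r, r₁, r₂, by rw [hd₁, hd], by rw [hd₂, hd], ?_, rfl⟩
  intro x _
  simp only [hi, hi₁, hi₂, Pi.add_apply, ht]
  ring

/-- A real algebraic number has a real algebraic strict upper bound of its absolute value plus itself:
for `t ∈ K` there is `s ∈ K` with `0 < s` and `0 < t + s` (namely `s = |t| + 1`). [folklore] -/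
theorem exists_pos_add_pos (t : ↥(algebraicClosure ℚ ℝ)) :
    ∃ s : ↥(algebraicClosure ℚ ℝ), 0 < (s : ℝ) ∧ 0 < (t : ℝ) + (s : ℝ) := by
  have habs : IsAlgebraic ℚ |(t : ℝ)| := by
    rcases abs_choice (t : ℝ) with h | h
    · rw [h]; exact mem_algebraicClosure_iff.1 t.2
    · rw [h]; exact (mem_algebraicClosure_iff.1 t.2).neg
  refine ⟨⟨|(t : ℝ)| + 1, mem_algebraicClosure_iff.2 (habs.add isAlgebraic_one)⟩, ?_, ?_⟩
  · show 0 < |(t : ℝ)| + 1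
    positivity
  · show 0 < (t : ℝ) + (|(t : ℝ)| + 1)
    have := neg_abs_le (t : ℝ)
    linarith

/-- **Stub C of line `Sketch` (cell collapse over `ℚ̄ ∩ ℝ`).** Sector representations exist (S), the
x-map transfer (T), the orbit ratio (V) and real-period independence imply: every element of the
closure of the real-algebraic real-period sector generators with value `0` lies in `KZ.relations`.
See the module docstring for the proof. [cite: KontsevichZagier2001, §1.2] -/
theorem stub_algCellCollapse : (∀ (α β a : ℝ), IsAlgebraic ℚ α → IsAlgebraic ℚ β → IsAlgebraic ℚ a → 4 * α ^ 3 + 27 * β ^ 2 ≠ 0 → ∃ r : Literature.NumberTheory.Transcendental.KZ.IntegralRep 1, r.domain = {x | 0 < x 0 ^ 3 + α * x 0 + β} ∧ r.integrand = fun x => a / Real.sqrt (x 0 ^ 3 + α * x 0 + β)) → (∀ (α β α' β' : ℝ), IsAlgebraic ℚ α → IsAlgebraic ℚ β → IsAlgebraic ℚ α' → IsAlgebraic ℚ β' → 4 * α ^ 3 + 27 * β ^ 2 ≠ 0 → 4 * α' ^ 3 + 27 * β' ^ 2 ≠ 0 → (∃ (f g : Polynomial ℝ) (c : ℝ), (∀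 n, IsAlgebraic ℚ (f.coeff n)) ∧ (∀ n, IsAlgebraic ℚ (g.coeff n)) ∧ IsAlgebraic ℚ c ∧ Polynomial.derivative f * g - f * Polynomial.derivative g ≠ 0 ∧ Polynomial.C (c ^ 2) * g * (f ^ 3 + Polynomial.C α' * f * g ^ 2 + Polynomial.C β' * g ^ 3) = (Polynomial.X ^ 3 + Polynomial.C α * Polynomial.X + Polynomial.C β) * (Polynomial.derivative f * g - f * Polynomial.derivative g) ^ 2) → ∀ (a b : ℝ), IsAlgebraic ℚ a → IsAlgebraic ℚ b → 0 < a → 0 < b → ∀ (r r' : Literature.NumberTheory.Transcendental.KZ.IntegralRep 1), r.domain = {x | 0 < x 0 ^ 3 + α * x 0 + β} → Set.EqOn r.integrand (fun x => a / Real.sqrt (x 0 ^ 3 + α * x 0 + β)) r.domain → r'.domain = {x | 0 < x 0 ^ 3 + α' * x 0 + β'} → Set.EqOn r'.integrand (fun x => b / Real.sqrt (x 0 ^ 3 + α' * x 0 + β')) r'.domain → r.value = r'.value → Literature.NumberTheory.Transcendental.KZ.of r - Literature.NumberTheory.Transcendental.KZ.of r' ∈ Literature.NumberTheory.Transcendental.KZ.relations)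 → (∀ (α β α' β' : ℝ), IsAlgebraic ℚ α → IsAlgebraic ℚ β → IsAlgebraic ℚ α' → IsAlgebraic ℚ β' → 4 * α ^ 3 + 27 * β ^ 2 ≠ 0 → 4 * α' ^ 3 + 27 * β' ^ 2 ≠ 0 → (∃ (f g : Polynomial ℝ) (c : ℝ), (∀ n, IsAlgebraic ℚ (f.coeff n)) ∧ (∀ n, IsAlgebraic ℚ (g.coeff n)) ∧ IsAlgebraic ℚ c ∧ Polynomial.derivative f * g - f * Polynomial.derivative g ≠ 0 ∧ Polynomial.C (c ^ 2) * g * (f ^ 3 + Polynomial.C α' * f * g ^ 2 + Polynomial.C β' * g ^ 3) = (Polynomial.X ^ 3 + Polynomial.C α * Polynomial.X + Polynomial.C β) * (Polynomial.derivative f * g - f * Polynomial.derivative g) ^ 2) → ∃ q : ℝ, IsAlgebraic ℚ q ∧ 0 < q ∧ (∫ x in {x : Fin 1 → ℝ | 0 < x 0 ^ 3 + α * x 0 + β}, 1 / Real.sqrt (x 0 ^ 3 + α * x 0 + β)) = q * (∫ x in {x : Fin 1 → ℝ | 0 < x 0 ^ 3 + α' * x 0 + β'}, 1 / Real.sqrt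 (x 0 ^ 3 + α' * x 0 + β'))) → (∀ (k : ℕ) (α β q : Fin k → ℝ), (∀ i, IsAlgebraic ℚ (α i) ∧ IsAlgebraic ℚ (β i) ∧ IsAlgebraic ℚ (q i)) → (∀ i, 4 * α i ^ 3 + 27 * β i ^ 2 ≠ 0) → (∀ i j, i ≠ j → ¬ (∃ (f g : Polynomial ℝ) (c : ℝ), (∀ n, IsAlgebraic ℚ (f.coeff n)) ∧ (∀ n, IsAlgebraic ℚ (g.coeff n)) ∧ IsAlgebraic ℚ c ∧ Polynomial.derivative f * g - f * Polynomial.derivative g ≠ 0 ∧ Polynomial.C (c ^ 2) * g * (f ^ 3 + Polynomial.C (α j) * f * g ^ 2 + Polynomial.C (β j) * g ^ 3) = (Polynomial.X ^ 3 + Polynomial.C (α i) * Polynomial.X + Polynomial.C (β i)) * (Polynomial.derivative f * g - f * Polynomial.derivative g) ^ 2)) → ∑ i, q i * (∫ x in {x : Fin 1 → ℝ | 0 < x 0 ^ 3 + α i * x 0 + β i}, 1 / Real.sqrt (x 0 ^ 3 + α i * x 0 + β i)) = 0 → ∀ i, q i = 0) → ∀ c ∈ AddSubgroup.closure {d : Literature.NumberTheory.Transcendental.KZ.FormalRep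 | ∃ (α β a : ℝ) (r : Literature.NumberTheory.Transcendental.KZ.IntegralRep 1), IsAlgebraic ℚ α ∧ IsAlgebraic ℚ β ∧ IsAlgebraic ℚ a ∧ 4 * α ^ 3 + 27 * β ^ 2 ≠ 0 ∧ r.domain = {x | 0 < x 0 ^ 3 + α * x 0 + β} ∧ Set.EqOn r.integrand (fun x => a / Real.sqrt (x 0 ^ 3 + α * x 0 + β)) r.domain ∧ d = Literature.NumberTheory.Transcendental.KZ.of r}, Literature.NumberTheory.Transcendental.KZ.eval c = 0 → c ∈ Literature.NumberTheory.Transcendental.KZ.relations := by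
  intro hS hT hV hI c hc hc0
  classical
  -- the coefficient field `K = ℚ̄ ∩ ℝ`
  have halg : ∀ z : ↥(algebraicClosure ℚ ℝ), IsAlgebraic ℚ (z : ℝ) := fun z => mem_algebraicClosure_iff.1 z.2
  -- (S): canonical representations, indexed by `p = (α, β) ∈ K²`, `t ∈ K`
  choose R hRd hRi using hS
  let Rr : (p : ↥(algebraicClosure ℚ ℝ) × ↥(algebraicClosure ℚ ℝ)) → ↥(algebraicClosure ℚ ℝ) →
      4 * (p.1 : ℝ) ^ 3 + 27 * (p.2 : ℝ) ^ 2 ≠ 0 → KZ.IntegralRep 1 :=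
    fun p t h => R p.1 p.2 t (halg p.1) (halg p.2) (halg t) h
  have hRrd : ∀ p t h, (Rr p t h).domain = {x | 0 < x 0 ^ 3 + (p.1 : ℝ) * x 0 + (p.2 : ℝ)} :=
    fun p t h => hRd _ _ _ _ _ _ _
  have hRri : ∀ p t h, (Rr p t h).integrand =
      fun x => (t : ℝ) / Real.sqrt (x 0 ^ 3 + (p.1 : ℝ) * x 0 + (p.2 : ℝ)) :=
    fun p t h => hRi _ _ _ _ _ _ _
  -- the full real period of the curve `p = (α, β)`
  let ω : ↥(algebraicClosure ℚ ℝ) × ↥(algebraicClosure ℚ ℝ) → ℝ := fun p =>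
    ∫ x in {x : Fin 1 → ℝ | 0 < x 0 ^ 3 + (p.1 : ℝ) * x 0 + (p.2 : ℝ)},
      1 / Real.sqrt (x 0 ^ 3 + (p.1 : ℝ) * x 0 + (p.2 : ℝ))
  -- the quotient by the relations
  set G : AddSubgroup KZ.FormalRep := KZ.relations with hG
  let π : KZ.FormalRep →+ KZ.FormalRep ⧸ G := QuotientAddGroup.mk' G
  have hπ : ∀ x, π x = 0 ↔ x ∈ G := fun x => QuotientAddGroup.eq_zero_iff x
  have hrelG : ∀ {x}, x ∈ KZ.relations → π x = 0 := fun hx => (hπ _).2 (by rw [hG]; exact hx)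
  -- additivity of `t ↦ [R(p,t)]` modulo relations
  have hadd : ∀ (p : ↥(algebraicClosure ℚ ℝ) × ↥(algebraicClosure ℚ ℝ))
      (h : 4 * (p.1 : ℝ) ^ 3 + 27 * (p.2 : ℝ) ^ 2 ≠ 0) (t₁ t₂ : ↥(algebraicClosure ℚ ℝ)),
      π (KZ.of (Rr p (t₁ + t₂) h)) = π (KZ.of (Rr p t₁ h)) + π (KZ.of (Rr p t₂ h)) := by
    intro p h t₁ t₂
    have hmem := sub_sub_mem_relations_of_integrand (by push_cast; rfl) (Rr p (t₁ + t₂) h) (Rr p t₁ h)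
      (Rr p t₂ h) (hRrd _ _ h) (hRrd _ _ h) (hRrd _ _ h) (hRri _ _ h) (hRri _ _ h) (hRri _ _ h)
    have h0 := hrelG hmem
    rw [map_sub, map_sub] at h0
    have := sub_eq_zero.1 h0
    rw [sub_eq_iff_eq_add] at this
    rw [this, add_comm]
  -- the per-curve homomorphisms `ψ p : K →+ Q`
  let ψ : ↥(algebraicClosure ℚ ℝ) × ↥(algebraicClosure ℚ ℝ) →
      (↥(algebraicClosure ℚ ℝ) →+ KZ.FormalRep ⧸ G) := fun p =>
    if h : 4 * (p.1 : ℝ) ^ 3 + 27 * (p.2 : ℝ) ^ 2 ≠ 0 then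
      AddMonoidHom.mk' (fun t => π (KZ.of (Rr p t h))) (fun t₁ t₂ => hadd p h t₁ t₂)
    else 0
  have hψ : ∀ (p : ↥(algebraicClosure ℚ ℝ) × ↥(algebraicClosure ℚ ℝ))
      (h : 4 * (p.1 : ℝ) ^ 3 + 27 * (p.2 : ℝ) ^ 2 ≠ 0) (t : ↥(algebraicClosure ℚ ℝ)),
      ψ p t = π (KZ.of (Rr p t h)) := by
    intro p h t
    simp only [ψ, dif_pos h, AddMonoidHom.mk'_apply]
  -- linear extensions to finitely supported coefficient vectors
  let Ψ : (↥(algebraicClosure ℚ ℝ) × ↥(algebraicClosure ℚ ℝ) →₀ ↥(algebraicClosure ℚ ℝ)) →+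
      KZ.FormalRep ⧸ G := Finsupp.liftAddHom ψ
  let φ : ↥(algebraicClosure ℚ ℝ) × ↥(algebraicClosure ℚ ℝ) → (↥(algebraicClosure ℚ ℝ) →+ ℝ) := fun p =>
    (AddMonoidHom.mulRight (ω p)).comp (algebraMap (↥(algebraicClosure ℚ ℝ)) ℝ : ↥(algebraicClosure ℚ ℝ) →+* ℝ).toAddMonoidHom
  let E : (↥(algebraicClosure ℚ ℝ) × ↥(algebraicClosure ℚ ℝ) →₀ ↥(algebraicClosure ℚ ℝ)) →+ ℝ :=
    Finsupp.liftAddHom φ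
  have hΨ1 : ∀ p t, Ψ (Finsupp.single p t) = ψ p t := fun p t => Finsupp.liftAddHom_apply_single ψ p t
  have hE1 : ∀ p t, E (Finsupp.single p t) = (t : ℝ) * ω p := fun p t => by
    simp only [E, Finsupp.liftAddHom_apply_single, φ, AddMonoidHom.coe_comp, Function.comp_apply,
      RingHom.toAddMonoidHom_eq_coe, AddMonoidHom.coe_coe, AddMonoidHom.coe_mulRight]
    rfl
  have hEsum : ∀ a : ↥(algebraicClosure ℚ ℝ) × ↥(algebraicClosure ℚ ℝ) →₀ ↥(algebraicClosure ℚ ℝ),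
      E a = ∑ p ∈ a.support, (a p : ℝ) * ω p := fun a => by
    simp only [E, Finsupp.liftAddHom_apply, Finsupp.sum, φ, AddMonoidHom.coe_comp, Function.comp_apply,
      RingHom.toAddMonoidHom_eq_coe, AddMonoidHom.coe_coe, AddMonoidHom.coe_mulRight]
    rfl
  -- STEP A: normal form of the sector closure in `Q`, with its value
  have stepA : ∀ x ∈ AddSubgroup.closure {d : KZ.FormalRep | ∃ (α β a : ℝ) (r : KZ.IntegralRep 1),
      IsAlgebraic ℚ α ∧ IsAlgebraic ℚ β ∧ IsAlgebraic ℚ a ∧ 4 * α ^ 3 + 27 * β ^ 2 ≠ 0 ∧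
      r.domain = {x | 0 < x 0 ^ 3 + α * x 0 + β} ∧
      Set.EqOn r.integrand (fun x => a / Real.sqrt (x 0 ^ 3 + α * x 0 + β)) r.domain ∧ d = KZ.of r},
      ∃ a : ↥(algebraicClosure ℚ ℝ) × ↥(algebraicClosure ℚ ℝ) →₀ ↥(algebraicClosure ℚ ℝ),
        (∀ p ∈ a.support, 4 * (p.1 : ℝ) ^ 3 + 27 * (p.2 : ℝ) ^ 2 ≠ 0) ∧ π x = Ψ a ∧ KZ.eval x = E a := by
    intro x hx
    induction hx using AddSubgroup.closure_induction with
    | mem x hx =>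
      obtain ⟨α, β, t, r, hα, hβ, ht, hns, hd, he, rfl⟩ := hx
      set p : ↥(algebraicClosure ℚ ℝ) × ↥(algebraicClosure ℚ ℝ) :=
        (⟨α, mem_algebraicClosure_iff.2 hα⟩, ⟨β, mem_algebraicClosure_iff.2 hβ⟩) with hp
      set tK : ↥(algebraicClosure ℚ ℝ) := ⟨t, mem_algebraicClosure_iff.2 ht⟩ with htK
      have hnsp : 4 * (p.1 : ℝ) ^ 3 + 27 * (p.2 : ℝ) ^ 2 ≠ 0 := hns
      refine ⟨Finsupp.single p tK, fun p' hp' => ?_, ?_, ?_⟩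
      · have := Finsupp.support_single_subset hp'
        rw [Finset.mem_singleton] at this
        rw [this]
        exact hnsp
      · -- `[r] = [R(p,t)]` in `Q`: same domain, integrands agree on it
        rw [hΨ1, hψ p hnsp]
        have heq : KZ.of r - KZ.of (Rr p tK hnsp) ∈ KZ.relations :=
          KZ.of_sub_of_mem_relations_of_eqOn (by rw [hRrd, hd]) (by rw [hRri]; exact he)
        have h0 := hrelG heq
        rw [map_sub, sub_eq_zero] at h0
        exact h0
      · rw [hE1, KZ.eval_of]
        exact PeriodRep.value_eq r hd he
    | zero => exact ⟨0, by simp, by simp, by simp⟩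
    | add x y _ _ ihx ihy =>
      obtain ⟨a, ha, hπa, hEa⟩ := ihx
      obtain ⟨b, hb, hπb, hEb⟩ := ihy
      refine ⟨a + b, fun p hp => ?_, by rw [map_add, map_add, hπa, hπb], by rw [map_add, map_add, hEa, hEb]⟩
      rcases Finset.mem_union.1 (Finsupp.support_add hp) with h | h
      · exact ha p h
      · exact hb p h
    | neg x _ ih =>
      obtain ⟨a, ha, hπa, hEa⟩ := ih
      exact ⟨-a, fun p hp => ha p (by rwa [Finsupp.support_neg] at hp), by rw [map_neg, map_neg, hπa],
        by rw [map_neg, map_neg, hEa]⟩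
  -- STEP B: collapse along data, induction on the size of the support
  have stepB : ∀ (n : ℕ) (a : ↥(algebraicClosure ℚ ℝ) × ↥(algebraicClosure ℚ ℝ) →₀ ↥(algebraicClosure ℚ ℝ)),
      a.support.card ≤ n → (∀ p ∈ a.support, 4 * (p.1 : ℝ) ^ 3 + 27 * (p.2 : ℝ) ^ 2 ≠ 0) →
      E a = 0 → Ψ a = 0 := by
    intro n
    induction n with
    | zero =>
      intro a hcard _ _
      have ha : a = 0 := by
        rwa [Nat.le_zero, Finset.card_eq_zero, Finsupp.support_eq_empty] at hcard
      rw [ha, map_zero]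
    | succ n ih =>
      intro a hcard hns hEa
      by_cases hrel : ∃ p ∈ a.support, ∃ p' ∈ a.support, p ≠ p' ∧
          ∃ (f g : Polynomial ℝ) (c : ℝ), (∀ n, IsAlgebraic ℚ (f.coeff n)) ∧ (∀ n, IsAlgebraic ℚ (g.coeff n)) ∧
          IsAlgebraic ℚ c ∧ Polynomial.derivative f * g - f * Polynomial.derivative g ≠ 0 ∧
          Polynomial.C (c ^ 2) * g * (f ^ 3 + Polynomial.C (p'.1 : ℝ) * f * g ^ 2 + Polynomial.C (p'.2 : ℝ) * g ^ 3) =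
            (Polynomial.X ^ 3 + Polynomial.C (p.1 : ℝ) * Polynomial.X + Polynomial.C (p.2 : ℝ)) *
              (Polynomial.derivative f * g - f * Polynomial.derivative g) ^ 2
      · -- collapse the curve `p` onto `p'`
        obtain ⟨p, hp, p', hp', hpp', hD⟩ := hrel
        have hnp := hns p hp
        have hnp' := hns p' hp'
        obtain ⟨q, hqalg, hq0, hΩ⟩ := hV p.1 p.2 p'.1 p'.2 (halg _) (halg _) (halg _) (halg _) hnp hnp' hD
        -- `hΩ : ω p = q * ω p'`
        have hΩ' : ω p = q * ω p' := hΩ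
        set qK : ↥(algebraicClosure ℚ ℝ) := ⟨q, mem_algebraicClosure_iff.2 hqalg⟩ with hqK
        have hqK' : (qK : ℝ) = q := rfl
        -- the transfer identifies `ψ p t` with `ψ p' (t * q)` for `t > 0` …
        have hpos : ∀ t : ↥(algebraicClosure ℚ ℝ), 0 < (t : ℝ) → ψ p t = ψ p' (t * qK) := by
          intro t ht
          rw [hψ p hnp, hψ p' hnp', ← sub_eq_zero, ← map_sub, hπ, hG]
          have hb : ((t * qK : ↥(algebraicClosure ℚ ℝ)) : ℝ) = (t : ℝ) * q := by push_cast; rw [hqK']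
          refine hT p.1 p.2 p'.1 p'.2 (halg _) (halg _) (halg _) (halg _) hnp hnp' hD t ((t * qK : ↥(algebraicClosure ℚ ℝ)) : ℝ)
            (halg _) (halg _) ht ?_ (Rr p t hnp) (Rr p' (t * qK) hnp') (hRrd _ _ hnp) ?_ (hRrd _ _ hnp') ?_ ?_
          · rw [hb]
            exact mul_pos ht hq0
          · rw [hRri]; exact fun x _ => rfl
          · rw [hRri]; exact fun x _ => rfl
          · rw [PeriodRep.value_eq (Rr p t hnp) (hRrd _ _ hnp) (by rw [hRri]; exact fun x _ => rfl),
              PeriodRep.value_eq (Rr p' (t * qK) hnp') (hRrd _ _ hnp') (by rw [hRri]; exact fun x _ => rfl), hb]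
            change (t : ℝ) * ω p = (t : ℝ) * q * ω p'
            rw [hΩ']
            ring
        -- … hence for all `t`, by additivity
        have key : ∀ t : ↥(algebraicClosure ℚ ℝ), ψ p t = ψ p' (t * qK) := by
          intro t
          obtain ⟨s, hs, hts⟩ := exists_pos_add_pos t
          have h1 := hpos s hs
          have h2 := hpos (t + s) (by push_cast; exact hts)
          have e1 : ψ p t = ψ p (t + s) - ψ p s := by rw [map_add]; abel
          rw [e1, h1, h2, ← map_sub]
          congr 1
          ring
        -- move the `p`-coefficient onto `p'`
        set a' : ↥(algebraicClosure ℚ ℝ) × ↥(algebraicClosure ℚ ℝ) →₀ ↥(algebraicClosure ℚ ℝ) :=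
          a - Finsupp.single p (a p) + Finsupp.single p' (a p * qK) with ha'
        have hΨ' : Ψ a' = Ψ a := by
          rw [ha', map_add, map_sub, hΨ1, hΨ1, key (a p)]
          abel
        have hE' : E a' = 0 := by
          rw [ha', map_add, map_sub, hE1, hE1, hEa, hΩ']
          push_cast
          rw [hqK']
          ring
        have hsupp' : a'.support ⊆ a.support.erase p := by
          intro x hx
          rw [Finsupp.mem_support_iff] at hx
          rw [Finset.mem_erase]
          have hx' : a' x = a x - (Finsupp.single p (a p)) x + (Finsupp.single p' (a p * qK)) x := by
            rw [ha']
            simp only [Finsupp.coe_add, Finsupp.coe_sub, Pi.add_apply, Pi.sub_apply]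
          rw [hx', Finsupp.single_apply, Finsupp.single_apply] at hx
          by_cases hxp : x = p
          · exfalso
            rw [if_pos hxp.symm, if_neg (fun h : p' = x => hpp' (h.trans hxp).symm), hxp] at hx
            exact hx (by ring)
          · refine ⟨hxp, ?_⟩
            rw [Finsupp.mem_support_iff]
            intro hax
            rw [hax, if_neg (fun h : p = x => hxp h.symm)] at hx
            by_cases hxp' : x = p'
            · rw [hxp'] at hax
              exact (Finsupp.mem_support_iff.1 hp') hax
            · rw [if_neg (fun h : p' = x => hxp' h.symm)] at hx
              exact hx (by ring)
        have hcard' : a'.support.card ≤ n := by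
          have h1 := Finset.card_le_card hsupp'
          rw [Finset.card_erase_of_mem hp] at h1
          omega
        have hns' : ∀ x ∈ a'.support, 4 * (x.1 : ℝ) ^ 3 + 27 * (x.2 : ℝ) ^ 2 ≠ 0 :=
          fun x hx => hns x (Finset.mem_of_mem_erase (hsupp' hx))
        rw [← hΨ']
        exact ih a' hcard' hns' hE'
      · -- pairwise unrelated support: (RPI) kills every coefficient, so the support is empty
        set k : ℕ := a.support.card with hk
        let e : Fin k ≃ {x // x ∈ a.support} := a.support.equivFin.symm
        have hzero := hI k (fun i => ((e i).1.1 : ℝ)) (fun i => ((e i).1.2 : ℝ)) (fun i => (a (e i).1 : ℝ))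
          (fun i => ⟨halg _, halg _, halg _⟩) (fun i => hns _ (e i).2) ?_ ?_
        · -- every coefficient on the support vanishes: the support is empty
          have hk0 : k = 0 := by
            by_contra hk0
            have i : Fin k := ⟨0, Nat.pos_of_ne_zero hk0⟩
            have h0 : (a (e i).1 : ℝ) = 0 := hzero i
            exact (Finsupp.mem_support_iff.1 (e i).2) (by exact_mod_cast h0)
          have ha0 : a = 0 := by
            rw [← Finsupp.support_eq_empty, ← Finset.card_eq_zero]
            exact hk0
          rw [ha0, map_zero]
        · intro i j hij hD
          have hne : (e i).1 ≠ (e j).1 := fun h => hij (e.injective (Subtype.ext h))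
          exact hrel ⟨_, (e i).2, _, (e j).2, hne, hD⟩
        · -- the value: `∑ᵢ a(eᵢ) Ω(eᵢ) = ∑_{x ∈ support} a x · Ω x = E a = 0`
          have h1 : ∑ i : Fin k, (a (e i).1 : ℝ) * ω (e i).1 = ∑ x ∈ a.support, (a x : ℝ) * ω x := by
            rw [Equiv.sum_comp e (fun x => (a x.1 : ℝ) * ω x.1)]
            exact Finset.sum_coe_sort a.support (fun x => (a x : ℝ) * ω x)
          change ∑ i : Fin k, (a (e i).1 : ℝ) * ω (e i).1 = 0
          rw [h1, ← hEsum, hEa]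
  -- conclusion
  obtain ⟨a, ha, hπa, hEa⟩ := stepA c hc
  have hΨa : Ψ a = 0 := stepB _ a le_rfl ha (by rw [← hEa, hc0])
  have : π c = 0 := by rw [hπa, hΨa]
  rw [hπ, hG] at this
  exact this

end Summit.KontsevichZagierPeriods.IsogenyCertificates.AlgRealPeriodCell.CellCollapse

end
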